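/-
Copyright (c) 2026. Released under Apache 2.0 license.
Literature formalization: the matrix `H_x` of PSLQ and Theorem 1 in its printed form
(Ferguson–Bailey–Arno 1999, Definition 2, Lemmas 1–2, Theorem 1), real case.
-/
import Mathlib
import Literature.NumberTheory.DiophantineApproximation.PSLQRelationBound

/-!
# The matrix `H_x` of PSLQ (Ferguson–Bailey–Arno 1999, Definition 2, Lemmas 1–2) and Theorem 1 verbatim

Topic `Literature/NumberTheory/DiophantineApproximation`. H. R. P. Ferguson, D. H. Bailey, S. Arno,
*Analysis of PSLQ, an integer relation finding algorithm*, Math. Comp. 68 (1999), no. 225, 351–369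
[FergusonBaileyArno1999]: Definition 2, Lemma 1, Lemma 2 (pp. 353–354) with their printed proofs, and
Theorem 1 (p. 354) in the form printed there, in the real case `K = ℝ`, `O(K) = ℤ`. This file
completes `PSLQRelationBound.lean`, which proves Theorem 1 in a FACTORED form
(`FergusonBaileyArno1999_theorem1`: any factorisation `A P = L R`, `P` fixing `x^⊥`, `L` lower
triangular, rows of `R` of norm `≤ 1`) and deliberately left the matrix `H_x` out; here `H_x` is
constructed, Lemmas 1–2 are proved, and the factored theorem is instantiated exactly as in the printed
proof (p. 355: `A P_x = (A H_x Q)(Qᵀ H_xᵀ)`, "`Qᵀ H_xᵀ` with orthonormal rows, since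
`Qᵀ H_xᵀ H_x Q = Qᵀ I_{n−1} Q = I_{n−1}` by Lemma 1").

Throughout `n = d + 1`, vectors are `x : Fin (d + 1) → ℝ`, and the paper's indices `1 ≤ j ≤ n − 1`
are `j : Fin d`, with `j.castSucc : Fin (d + 1)` the row index of the diagonal entry `h_{j,j}` and
`j.succ` the index `j + 1`.

**Definition 2 (`H_x`), verbatim.** "Assume `x = (x₁, …, xₙ) ∈ Kⁿ` has norm `|x| = 1`. Furthermore,
suppose that no coordinate entry of `x` is zero, i.e., `xⱼ ≠ 0` for `1 ≤ j ≤ n` (otherwise `x` has an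
immediate and obvious integral relation). For `1 ≤ j ≤ n` define the partial sums
`sⱼ² = ∑_{j ≤ k ≤ n} x_k x_k*`. Given such a unit vector `x`, define the `n × (n − 1)` lower trapezoidal
matrix `H_x = (h_{i,j})` by `h_{i,j} = 0` if `1 ≤ i < j ≤ n − 1`, `h_{i,j} = s_{i+1}/s_i` if
`1 ≤ i = j ≤ n − 1`, `h_{i,j} = −x_i* x_j/(s_j s_{j+1})` if `1 ≤ j < i ≤ n`."
Here: `pslqPartialSq x k = s_k²`, `pslqPartialNorm x k = s_k`, `pslqH x = H_x`.

**Lemma 1, verbatim.** "(i) `H_x* H_x = I_{n−1}`, i.e., the columns of `H_x` are orthogonal,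
(ii) `|H_x| = √(n − 1)`, (iii) `x H_x = 0`." — `pslqH_transpose_mul_self`, `pslqH_frobenius_sq`
(stated as `|H_x|² = n − 1`), `vecMul_pslqH`. As in the printed proof these use only `xⱼ ≠ 0` (all
`s_j > 0`), NOT `|x| = 1` ("Note that `h_{i,j}` is scale invariant").

**Lemma 2, verbatim.** "For a unit vector `x ∈ Kⁿ` define `P_x = H_x H_x*`. Then `P_x` satisfies:
(i) `P_x* = P_x`, (ii) `P_x = Iₙ − x* x`, (iii) `P_x² = P_x`, (iv) `|P_x| = √(n − 1)`,
(v) `P_x z* = z*` for any `z ∈ x^⊥`, (vi) `P_x m* = m*` for any relation `m ∈ O(K)ⁿ` for `x`." —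
`pslqP_transpose`, `pslqP_eq`, `pslqP_mul_self`, `trace_pslqP` / `pslqP_frobenius_sq`,
`pslqP_mulVec_of_orthogonal`, `pslqP_mulVec_relation`. Item (ii) is proved as printed: the square
matrix `U = (H_x | xᵀ)` (`pslqU`) has `Uᵀ U = Iₙ` by Lemma 1 (i), (iii) and `|x| = 1`, hence
`U Uᵀ = H_x H_xᵀ + xᵀ x = Iₙ`.

**Theorem 1, verbatim.** "Let `x ≠ 0 ∈ Kⁿ`. Suppose that for any relation `m` of `x` and for any
matrix `A ∈ GL(n, O(K))` there exists a unitary matrix `Q ∈ U(n − 1)` such that `H = A H_x Q` is lower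
trapezoidal and all of the diagonal elements of `H` satisfy `h_{j,j} ≠ 0`. Then
`1 / max_{1 ≤ j ≤ n−1} |h_{j,j}| = min_{1 ≤ j ≤ n−1} 1/|h_{j,j}| ≤ |m|`." —
`FergusonBaileyArno1999_theorem1_pslqH` (`∃ j, 1 ≤ |h_{j,j}| · |m|`), `…_min`
(`∃ j, 1/|h_{j,j}| ≤ |m|`, the `min` form), `…_max` (`1/D ≤ |m|` for every `D` dominating the
`|h_{j,j}|`) and `…_iSup` (`1 / ⨆ⱼ |h_{j,j}| ≤ |m|`, the `max` form literally). As in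
`PSLQRelationBound.lean`, `A` need only be an integer matrix with `det A ≠ 0` (every
`A ∈ GL(n, ℤ)` qualifies) and `Q` a real matrix with `Qᵀ Q = I` (= orthogonal, the real unitary
group); the hypotheses are stated for the one relation `m` and the one pair `(A, Q)` at hand, which is
how the theorem is applied ("Comment on Theorem 1": "Theorem 1 can be used with any algorithm that
produces any `GL(n, O(K))` matrices. Any `GL(n, O(K))` matrix `A` whatsoever can be put into Theorem 1.").

Deliberately NOT here: Hermite reduction and the PSLQ iteration (Definitions 3–6), Theorems 2–3
(termination and the `γ^{n−2}` norm bound), the complex and quaternion cases.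

USE: this is the statement behind the EXCLUSION BOUND reported by PSLQ implementations — after any
number of exact (or validated) iterations with accumulated integer matrix `A` and current lower
trapezoidal `H = A H_x Q`, every integer relation of `x` has Euclidean norm `≥ 1 / max_j |h_{j,j}|`.

## References

* [FergusonBaileyArno1999] H. R. P. Ferguson, D. H. Bailey, S. Arno, Analysis of PSLQ, an integer
  relation finding algorithm, Math. Comp. 68 (1999) 351–369: Definition 2, Lemma 1, Lemma 2 and their
  proofs (pp. 353–354), Theorem 1 and its proof (pp. 354–355). doi:10.1090/S0025-5718-99-00995-3
-/

namespace Literature.NumberTheory.DiophantineApproximation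

open Matrix Finset

variable {d : ℕ}

/-- **Definition 2, the partial sums** `s_k² = ∑_{k ≤ i ≤ n} x_i²` (`x ∈ ℝⁿ`, `n = d + 1`, `k : Fin (d+1)`).
[cite: FergusonBaileyArno1999, Definition 2] -/
def pslqPartialSq (x : Fin (d + 1) → ℝ) (k : Fin (d + 1)) : ℝ :=
  ∑ i ∈ univ.filter (fun i => k ≤ i), x i ^ 2

/-- **Definition 2**: `s_k = (∑_{k ≤ i ≤ n} x_i²)^{1/2}`. [cite: FergusonBaileyArno1999, Definition 2] -/
noncomputable def pslqPartialNorm (x : Fin (d + 1) → ℝ) (k : Fin (d + 1)) : ℝ :=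
  Real.sqrt (pslqPartialSq x k)

/-- **Definition 2, the `n × (n − 1)` lower trapezoidal matrix `H_x = (h_{i,j})`**: `h_{i,j} = 0` for
`i < j`, `h_{j,j} = s_{j+1}/s_j`, and `h_{i,j} = −x_i x_j/(s_j s_{j+1})` for `j < i` (real case; rows
`i : Fin (d+1)`, columns `j : Fin d`, the diagonal entry of column `j` sits in row `j.castSucc`).
[cite: FergusonBaileyArno1999, Definition 2] -/
noncomputable def pslqH (x : Fin (d + 1) → ℝ) : Matrix (Fin (d + 1)) (Fin d) ℝ :=
  Matrix.of fun i j =>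
    if i < j.castSucc then 0
    else if i = j.castSucc then pslqPartialNorm x j.succ / pslqPartialNorm x j.castSucc
    else -(x i * x j.castSucc) / (pslqPartialNorm x j.castSucc * pslqPartialNorm x j.succ)

/-- Splitting a sum over `Fin (d + 1)` at a pivot `p`: the terms below `p`, the term at `p`, the terms
above `p` (the case distinction "`i = j` and `i < j` separately" of the printed proofs). [folklore] -/
private theorem sum_univ_split_at (p : Fin (d + 1)) (f : Fin (d + 1) → ℝ) :
    ∑ i, f i = (∑ i ∈ univ.filter (fun i => i < p), f i) + f p
      + ∑ i ∈ univ.filter (fun i => p < i), f i := by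
  classical
  rw [← Finset.sum_filter_add_sum_filter_not univ (fun i => i < p)]
  have h1 : univ.filter (fun i : Fin (d + 1) => ¬ i < p) = univ.filter (fun i => p ≤ i) := by
    ext i; simp [not_lt]
  rw [h1, ← Finset.sum_filter_add_sum_filter_not (univ.filter fun i : Fin (d + 1) => p ≤ i)
    (fun i => i = p)]
  have h2 : (univ.filter fun i : Fin (d + 1) => p ≤ i).filter (fun i => i = p) = {p} := by
    ext i
    simp only [Finset.mem_filter, Finset.mem_univ, true_and, Finset.mem_singleton]
    constructor
    · rintro ⟨-, rfl⟩; rfl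
    · rintro rfl; exact ⟨le_rfl, rfl⟩
  have h3 : (univ.filter fun i : Fin (d + 1) => p ≤ i).filter (fun i => ¬ i = p)
      = univ.filter (fun i => p < i) := by
    ext i
    simp only [Finset.mem_filter, Finset.mem_univ, true_and]
    constructor
    · rintro ⟨h, hne⟩; exact lt_of_le_of_ne h (Ne.symm hne)
    · intro h; exact ⟨h.le, h.ne'⟩
  rw [h2, h3, Finset.sum_singleton, add_assoc]

/-- `s_k² = x_k² + ∑_{k < i} x_i²`. [cite: FergusonBaileyArno1999, Definition 2] -/
theorem pslqPartialSq_eq_add (x : Fin (d + 1) → ℝ) (k : Fin (d + 1)) :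
    pslqPartialSq x k = x k ^ 2 + ∑ i ∈ univ.filter (fun i => k < i), x i ^ 2 := by
  classical
  unfold pslqPartialSq
  rw [← Finset.sum_filter_add_sum_filter_not (univ.filter fun i : Fin (d + 1) => k ≤ i)
    (fun i => i = k)]
  have h2 : (univ.filter fun i : Fin (d + 1) => k ≤ i).filter (fun i => i = k) = {k} := by
    ext i
    simp only [Finset.mem_filter, Finset.mem_univ, true_and, Finset.mem_singleton]
    constructor
    · rintro ⟨-, rfl⟩; rfl
    · rintro rfl; exact ⟨le_rfl, rfl⟩
  have h3 : (univ.filter fun i : Fin (d + 1) => k ≤ i).filter (fun i => ¬ i = k)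
      = univ.filter (fun i => k < i) := by
    ext i
    simp only [Finset.mem_filter, Finset.mem_univ, true_and]
    constructor
    · rintro ⟨h, hne⟩; exact lt_of_le_of_ne h (Ne.symm hne)
    · intro h; exact ⟨h.le, h.ne'⟩
  rw [h2, h3, Finset.sum_singleton]

/-- `s_{j+1}² = ∑_{j < i} x_i²` (the sums `∑_{j < k ≤ n} x_k x_k*` of the proof of Lemma 1).
[cite: FergusonBaileyArno1999, Definition 2] -/
theorem pslqPartialSq_succ (x : Fin (d + 1) → ℝ) (j : Fin d) :
    pslqPartialSq x j.succ = ∑ i ∈ univ.filter (fun i => j.castSucc < i), x i ^ 2 := by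
  unfold pslqPartialSq
  refine Finset.sum_congr ?_ fun _ _ => rfl
  ext i
  simp only [Finset.mem_filter, Finset.mem_univ, true_and]
  exact (Fin.castSucc_lt_iff_succ_le).symm

/-- `s_j² = x_j² + s_{j+1}²` ("`(s_j² − x_j x_j*)/s_j² + x_j x_j*/s_j² = 1`" in the proof of Lemma 1).
[cite: FergusonBaileyArno1999, Definition 2] -/
theorem pslqPartialSq_castSucc (x : Fin (d + 1) → ℝ) (j : Fin d) :
    pslqPartialSq x j.castSucc = x j.castSucc ^ 2 + pslqPartialSq x j.succ := by
  rw [pslqPartialSq_eq_add, pslqPartialSq_succ]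

/-- `s_1² = ∑ᵢ x_i² = |x|²`. [cite: FergusonBaileyArno1999, Definition 2] -/
theorem pslqPartialSq_zero (x : Fin (d + 1) → ℝ) : pslqPartialSq x 0 = ∑ i, x i ^ 2 := by
  unfold pslqPartialSq
  refine Finset.sum_congr ?_ fun _ _ => rfl
  ext i
  simp

/-- `0 ≤ s_k²`. [cite: FergusonBaileyArno1999, Definition 2] -/
theorem pslqPartialSq_nonneg (x : Fin (d + 1) → ℝ) (k : Fin (d + 1)) : 0 ≤ pslqPartialSq x k :=
  Finset.sum_nonneg fun i _ => sq_nonneg (x i)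

/-- `s_k² > 0` when no coordinate of `x` vanishes (Definition 2: "suppose that no coordinate entry of
`x` is zero … (otherwise `x` has an immediate and obvious integral relation)").
[cite: FergusonBaileyArno1999, Definition 2] -/
theorem pslqPartialSq_pos (x : Fin (d + 1) → ℝ) (h0 : ∀ i, x i ≠ 0) (k : Fin (d + 1)) :
    0 < pslqPartialSq x k := by
  rw [pslqPartialSq_eq_add]
  have hk : x k ≠ 0 := h0 k
  have h1 : 0 < x k ^ 2 := by positivity
  have h2 : 0 ≤ ∑ i ∈ univ.filter (fun i => k < i), x i ^ 2 :=
    Finset.sum_nonneg fun i _ => sq_nonneg (x i)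
  linarith

/-- `s_k > 0` when no coordinate of `x` vanishes. [cite: FergusonBaileyArno1999, Definition 2] -/
theorem pslqPartialNorm_pos (x : Fin (d + 1) → ℝ) (h0 : ∀ i, x i ≠ 0) (k : Fin (d + 1)) :
    0 < pslqPartialNorm x k :=
  Real.sqrt_pos.mpr (pslqPartialSq_pos x h0 k)

/-- `(s_k)² = s_k²`. [cite: FergusonBaileyArno1999, Definition 2] -/
theorem pslqPartialNorm_sq (x : Fin (d + 1) → ℝ) (k : Fin (d + 1)) :
    pslqPartialNorm x k ^ 2 = pslqPartialSq x k :=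
  Real.sq_sqrt (pslqPartialSq_nonneg x k)

/-- `h_{i,j} = 0` above the diagonal. [cite: FergusonBaileyArno1999, Definition 2] -/
theorem pslqH_apply_of_lt (x : Fin (d + 1) → ℝ) {i : Fin (d + 1)} {j : Fin d}
    (h : i < j.castSucc) : pslqH x i j = 0 := by
  simp [pslqH, h]

/-- `h_{j,j} = s_{j+1}/s_j`. [cite: FergusonBaileyArno1999, Definition 2] -/
theorem pslqH_apply_diag (x : Fin (d + 1) → ℝ) (j : Fin d) :
    pslqH x j.castSucc j = pslqPartialNorm x j.succ / pslqPartialNorm x j.castSucc := by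
  simp [pslqH]

/-- `h_{i,j} = −x_i x_j/(s_j s_{j+1})` below the diagonal. [cite: FergusonBaileyArno1999, Definition 2] -/
theorem pslqH_apply_of_gt (x : Fin (d + 1) → ℝ) {i : Fin (d + 1)} {j : Fin d}
    (h : j.castSucc < i) :
    pslqH x i j = -(x i * x j.castSucc) / (pslqPartialNorm x j.castSucc * pslqPartialNorm x j.succ) := by
  have h1 : ¬ i < j.castSucc := not_lt.mpr h.le
  have h2 : i ≠ j.castSucc := h.ne'
  simp [pslqH, h1, h2]

/-- **Lemma 1 (i), case `i = j`** of the printed proof: each column of `H_x` is a unit vector,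
`∑ᵢ h_{i,j}² = s_{j+1}²/s_j² + x_j² (∑_{j<k} x_k²)/(s_j² s_{j+1}²) = (s_{j+1}² + x_j²)/s_j² = 1`.
[cite: FergusonBaileyArno1999, Lemma 1 (i)] -/
theorem pslqH_col_sq (x : Fin (d + 1) → ℝ) (h0 : ∀ i, x i ≠ 0) (j : Fin d) :
    ∑ i, pslqH x i j * pslqH x i j = 1 := by
  rw [sum_univ_split_at j.castSucc]
  have hA : ∑ i ∈ univ.filter (fun i => i < j.castSucc), pslqH x i j * pslqH x i j = 0 := by
    refine Finset.sum_eq_zero fun i hi => ?_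
    have hi' : i < j.castSucc := by simpa using hi
    rw [pslqH_apply_of_lt x hi', mul_zero]
  set s := pslqPartialNorm x j.castSucc with hs
  set t := pslqPartialNorm x j.succ with ht
  set a := x j.castSucc with ha
  have hs0 : 0 < s := pslqPartialNorm_pos x h0 _
  have ht0 : 0 < t := pslqPartialNorm_pos x h0 _
  have hst : s ^ 2 = a ^ 2 + t ^ 2 := by
    rw [hs, ht, pslqPartialNorm_sq, pslqPartialNorm_sq, pslqPartialSq_castSucc]
  have ht2 : ∑ i ∈ univ.filter (fun i => j.castSucc < i), x i ^ 2 = t ^ 2 := by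
    rw [ht, pslqPartialNorm_sq, pslqPartialSq_succ]
  have hC : ∑ i ∈ univ.filter (fun i => j.castSucc < i), pslqH x i j * pslqH x i j
      = (a / (s * t)) ^ 2 * t ^ 2 := by
    rw [← ht2, Finset.mul_sum]
    refine Finset.sum_congr rfl fun i hi => ?_
    have hi' : j.castSucc < i := by simpa using hi
    rw [pslqH_apply_of_gt x hi']
    ring
  rw [hA, hC, pslqH_apply_diag, zero_add]
  rw [← hs, ← ht]
  have hs' : s ≠ 0 := hs0.ne'
  have ht' : t ≠ 0 := ht0.ne'
  field_simp
  nlinarith [hst]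


/-- **Lemma 1 (i), case `i < j`** of the printed proof: distinct columns of `H_x` are orthogonal,
`−x_i x_j s_{j+1}/(s_i s_{i+1} s_j) + x_i x_j (∑_{j<k} x_k²)/(s_i s_{i+1} s_j s_{j+1}) = 0` (stated for
columns `j < j'`). [cite: FergusonBaileyArno1999, Lemma 1 (i)] -/
theorem pslqH_col_orth (x : Fin (d + 1) → ℝ) (h0 : ∀ i, x i ≠ 0) {j j' : Fin d} (hjj : j < j') :
    ∑ i, pslqH x i j * pslqH x i j' = 0 := by
  have hcs : j.castSucc < j'.castSucc := Fin.castSucc_lt_castSucc_iff.mpr hjj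
  rw [sum_univ_split_at j'.castSucc]
  have hA : ∑ i ∈ univ.filter (fun i => i < j'.castSucc), pslqH x i j * pslqH x i j' = 0 := by
    refine Finset.sum_eq_zero fun i hi => ?_
    have hi' : i < j'.castSucc := by simpa using hi
    rw [pslqH_apply_of_lt x hi', mul_zero]
  set s := pslqPartialNorm x j.castSucc with hs
  set t := pslqPartialNorm x j.succ with ht
  set a := x j.castSucc with ha
  set s' := pslqPartialNorm x j'.castSucc with hs'
  set t' := pslqPartialNorm x j'.succ with ht'
  set a' := x j'.castSucc with ha'
  have hs0 : 0 < s := pslqPartialNorm_pos x h0 _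
  have ht0 : 0 < t := pslqPartialNorm_pos x h0 _
  have hs0' : 0 < s' := pslqPartialNorm_pos x h0 _
  have ht0' : 0 < t' := pslqPartialNorm_pos x h0 _
  have ht2 : ∑ i ∈ univ.filter (fun i => j'.castSucc < i), x i ^ 2 = t' ^ 2 := by
    rw [ht', pslqPartialNorm_sq, pslqPartialSq_succ]
  have hC : ∑ i ∈ univ.filter (fun i => j'.castSucc < i), pslqH x i j * pslqH x i j'
      = (a * a' / (s * t * (s' * t'))) * t' ^ 2 := by
    rw [← ht2, Finset.mul_sum]
    refine Finset.sum_congr rfl fun i hi => ?_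
    have hi' : j'.castSucc < i := by simpa using hi
    rw [pslqH_apply_of_gt x (hcs.trans hi'), pslqH_apply_of_gt x hi']
    ring
  rw [hA, hC, pslqH_apply_of_gt x hcs, pslqH_apply_diag, zero_add]
  rw [← hs, ← ht, ← hs', ← ht', ← ha']
  have hsn : s ≠ 0 := hs0.ne'
  have htn : t ≠ 0 := ht0.ne'
  have hsn' : s' ≠ 0 := hs0'.ne'
  have htn' : t' ≠ 0 := ht0'.ne'
  field_simp
  ring

/-- **Lemma 1 (i)** [FergusonBaileyArno1999]: `H_xᵀ H_x = I_{n−1}` ("the columns of `H_x` are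
orthogonal"), for every real `x` with no zero coordinate. [cite: FergusonBaileyArno1999, Lemma 1 (i)] -/
theorem pslqH_transpose_mul_self (x : Fin (d + 1) → ℝ) (h0 : ∀ i, x i ≠ 0) :
    (pslqH x)ᵀ * pslqH x = 1 := by
  ext j j'
  rw [Matrix.mul_apply, Matrix.one_apply]
  simp only [Matrix.transpose_apply]
  rcases lt_trichotomy j j' with h | rfl | h
  · rw [if_neg h.ne, pslqH_col_orth x h0 h]
  · rw [if_pos rfl, pslqH_col_sq x h0]
  · rw [if_neg h.ne']
    calc ∑ i, pslqH x i j * pslqH x i j' = ∑ i, pslqH x i j' * pslqH x i j :=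
          Finset.sum_congr rfl fun i _ => mul_comm _ _
      _ = 0 := pslqH_col_orth x h0 h

/-- **Lemma 1 (iii)** [FergusonBaileyArno1999]: `x H_x = 0`, i.e. every column of `H_x` lies in `x^⊥`
(printed proof: `x_j s_{j+1}/s_j − ∑_{j<k} x_k x_k x_j/(s_j s_{j+1}) = x_j s_{j+1}/s_j − x_j s_{j+1}²/(s_j s_{j+1}) = 0`).
[cite: FergusonBaileyArno1999, Lemma 1 (iii)] -/
theorem vecMul_pslqH (x : Fin (d + 1) → ℝ) (h0 : ∀ i, x i ≠ 0) : x ᵥ* pslqH x = 0 := by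
  funext j
  rw [Pi.zero_apply, Matrix.vecMul, dotProduct, sum_univ_split_at j.castSucc]
  have hA : ∑ i ∈ univ.filter (fun i => i < j.castSucc), x i * pslqH x i j = 0 := by
    refine Finset.sum_eq_zero fun i hi => ?_
    have hi' : i < j.castSucc := by simpa using hi
    rw [pslqH_apply_of_lt x hi', mul_zero]
  set s := pslqPartialNorm x j.castSucc with hs
  set t := pslqPartialNorm x j.succ with ht
  set a := x j.castSucc with ha
  have hs0 : 0 < s := pslqPartialNorm_pos x h0 _
  have ht0 : 0 < t := pslqPartialNorm_pos x h0 _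
  have ht2 : ∑ i ∈ univ.filter (fun i => j.castSucc < i), x i ^ 2 = t ^ 2 := by
    rw [ht, pslqPartialNorm_sq, pslqPartialSq_succ]
  have hC : ∑ i ∈ univ.filter (fun i => j.castSucc < i), x i * pslqH x i j
      = -(a / (s * t)) * t ^ 2 := by
    rw [← ht2, Finset.mul_sum]
    refine Finset.sum_congr rfl fun i hi => ?_
    have hi' : j.castSucc < i := by simpa using hi
    rw [pslqH_apply_of_gt x hi']
    ring
  rw [hA, hC, pslqH_apply_diag, zero_add, ← hs, ← ht]
  have hsn : s ≠ 0 := hs0.ne'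
  have htn : t ≠ 0 := ht0.ne'
  field_simp
  ring

/-- **Lemma 1 (ii)** [FergusonBaileyArno1999]: `|H_x| = √(n − 1)` for the Frobenius norm, stated as
`|H_x|² = ∑_{i,j} h_{i,j}² = n − 1` ("`H_x* H_x = I_{n−1}`, which has trace `n − 1`").
[cite: FergusonBaileyArno1999, Lemma 1 (ii)] -/
theorem pslqH_frobenius_sq (x : Fin (d + 1) → ℝ) (h0 : ∀ i, x i ≠ 0) :
    ∑ i, ∑ j, pslqH x i j ^ 2 = d := by
  rw [Finset.sum_comm]
  have : ∀ j : Fin d, ∑ i, pslqH x i j ^ 2 = 1 := fun j => by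
    simpa [sq] using pslqH_col_sq x h0 j
  simp [this]

/-- The square matrix `U = (H_x | xᵀ)` of the proof of Lemma 2 (ii) ("Defining `U = (H_x | x*)`, an
`n × n` unitary matrix"): columns `j.castSucc` are the columns of `H_x`, the last column is `x`.
[cite: FergusonBaileyArno1999, Lemma 2 (proof of (ii))] -/
noncomputable def pslqU (x : Fin (d + 1) → ℝ) : Matrix (Fin (d + 1)) (Fin (d + 1)) ℝ :=
  Matrix.of fun i k => Fin.lastCases (x i) (fun j => pslqH x i j) k

/-- The first `n − 1` columns of `U` are those of `H_x`. [cite: FergusonBaileyArno1999, Lemma 2 (proof of (ii))] -/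
theorem pslqU_apply_castSucc (x : Fin (d + 1) → ℝ) (i : Fin (d + 1)) (j : Fin d) :
    pslqU x i j.castSucc = pslqH x i j := by
  simp [pslqU]

/-- The last column of `U` is `x`. [cite: FergusonBaileyArno1999, Lemma 2 (proof of (ii))] -/
theorem pslqU_apply_last (x : Fin (d + 1) → ℝ) (i : Fin (d + 1)) :
    pslqU x i (Fin.last d) = x i := by
  simp [pslqU]

/-- `Uᵀ U = Iₙ` for a unit vector `x` with no zero coordinate: the blocks are `H_xᵀ H_x = I_{n−1}`
(Lemma 1 (i)), `H_xᵀ xᵀ = (x H_x)ᵀ = 0` (Lemma 1 (iii)) and `x xᵀ = |x|² = 1`.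
[cite: FergusonBaileyArno1999, Lemma 2 (proof of (ii))] -/
theorem pslqU_transpose_mul_self (x : Fin (d + 1) → ℝ) (h0 : ∀ i, x i ≠ 0)
    (h1 : ∑ i, x i ^ 2 = 1) : (pslqU x)ᵀ * pslqU x = 1 := by
  have hHH := pslqH_transpose_mul_self x h0
  have hxH := vecMul_pslqH x h0
  ext k k'
  rw [Matrix.mul_apply, Matrix.one_apply]
  simp only [Matrix.transpose_apply]
  induction k using Fin.lastCases with
  | last =>
    induction k' using Fin.lastCases with
    | last =>
      simp only [pslqU_apply_last, if_true]
      rw [← h1]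
      exact Finset.sum_congr rfl fun i _ => by ring
    | cast j' =>
      simp only [pslqU_apply_last, pslqU_apply_castSucc]
      rw [if_neg (Fin.castSucc_lt_last j').ne']
      have := congrFun hxH j'
      simpa [Matrix.vecMul, dotProduct] using this
  | cast j =>
    induction k' using Fin.lastCases with
    | last =>
      simp only [pslqU_apply_last, pslqU_apply_castSucc]
      rw [if_neg (Fin.castSucc_lt_last j).ne]
      have := congrFun hxH j
      simpa [Matrix.vecMul, dotProduct, mul_comm] using this
    | cast j' =>
      simp only [pslqU_apply_castSucc]
      have := congrFun (congrFun hHH j) j'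
      rw [Matrix.mul_apply, Matrix.one_apply] at this
      simp only [Matrix.transpose_apply] at this
      rw [this]
      by_cases h : j = j'
      · subst h; simp
      · rw [if_neg h, if_neg (fun e => h (Fin.castSucc_injective _ e))]

/-- `U Uᵀ = Iₙ` ("we have `U U* = H_x H_x* + x* x = Iₙ`"): a square matrix with a left inverse has it
as a right inverse. [cite: FergusonBaileyArno1999, Lemma 2 (proof of (ii))] -/
theorem pslqU_mul_transpose_self (x : Fin (d + 1) → ℝ) (h0 : ∀ i, x i ≠ 0)
    (h1 : ∑ i, x i ^ 2 = 1) : pslqU x * (pslqU x)ᵀ = 1 :=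
  mul_eq_one_comm.mp (pslqU_transpose_mul_self x h0 h1)

/-- **Lemma 2 (ii)** [FergusonBaileyArno1999], matrix form: `H_x H_xᵀ = Iₙ − xᵀ x` for a unit vector
`x` (`∑ᵢ x_i² = 1`) with no zero coordinate — read off from `U Uᵀ = H_x H_xᵀ + xᵀ x = Iₙ`.
[cite: FergusonBaileyArno1999, Lemma 2 (ii)] -/
theorem pslqH_mul_transpose_self (x : Fin (d + 1) → ℝ) (h0 : ∀ i, x i ≠ 0)
    (h1 : ∑ i, x i ^ 2 = 1) : pslqH x * (pslqH x)ᵀ = 1 - Matrix.vecMulVec x x := by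
  have hU := pslqU_mul_transpose_self x h0 h1
  ext i i'
  have := congrFun (congrFun hU i) i'
  rw [Matrix.mul_apply, Fin.sum_univ_castSucc] at this
  simp only [Matrix.transpose_apply, pslqU_apply_castSucc, pslqU_apply_last] at this
  rw [Matrix.sub_apply, Matrix.vecMulVec_apply, Matrix.mul_apply, ← this]
  simp only [Matrix.transpose_apply]
  ring


/-- **Lemma 2, the matrix `P_x = H_x H_xᵀ`** (real case). [cite: FergusonBaileyArno1999, Lemma 2] -/
noncomputable def pslqP (x : Fin (d + 1) → ℝ) : Matrix (Fin (d + 1)) (Fin (d + 1)) ℝ :=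
  pslqH x * (pslqH x)ᵀ

/-- **Lemma 2 (i)** [FergusonBaileyArno1999]: `P_xᵀ = P_x` ("follows from `H_x H_x* = (H_x H_x*)*`").
[cite: FergusonBaileyArno1999, Lemma 2 (i)] -/
theorem pslqP_transpose (x : Fin (d + 1) → ℝ) : (pslqP x)ᵀ = pslqP x := by
  rw [pslqP, Matrix.transpose_mul, Matrix.transpose_transpose]

/-- **Lemma 2 (ii)** [FergusonBaileyArno1999]: `P_x = Iₙ − xᵀ x` for a unit vector `x` with no zero
coordinate. [cite: FergusonBaileyArno1999, Lemma 2 (ii)] -/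
theorem pslqP_eq (x : Fin (d + 1) → ℝ) (h0 : ∀ i, x i ≠ 0) (h1 : ∑ i, x i ^ 2 = 1) :
    pslqP x = 1 - Matrix.vecMulVec x x :=
  pslqH_mul_transpose_self x h0 h1

/-- **Lemma 2 (iii)** [FergusonBaileyArno1999]: `P_x² = P_x`. (Proved here as
`H_x (H_xᵀ H_x) H_xᵀ = H_x H_xᵀ` from Lemma 1 (i), so the normalisation `|x| = 1` is not needed; the
printed proof expands `(Iₙ − x* x)²` instead.) [cite: FergusonBaileyArno1999, Lemma 2 (iii)] -/
theorem pslqP_mul_self (x : Fin (d + 1) → ℝ) (h0 : ∀ i, x i ≠ 0) : pslqP x * pslqP x = pslqP x := by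
  rw [pslqP, Matrix.mul_assoc, ← Matrix.mul_assoc (pslqH x)ᵀ, pslqH_transpose_mul_self x h0,
    Matrix.one_mul]

/-- **Lemma 2 (iv)**, trace form: `tr P_x = tr H_xᵀ H_x = n − 1` ("`|P_x|² = tr(P_x* P_x) = tr P_x =
tr H_x* H_x = n − 1`"). [cite: FergusonBaileyArno1999, Lemma 2 (iv)] -/
theorem trace_pslqP (x : Fin (d + 1) → ℝ) (h0 : ∀ i, x i ≠ 0) : Matrix.trace (pslqP x) = d := by
  rw [pslqP, Matrix.trace_mul_comm, pslqH_transpose_mul_self x h0, Matrix.trace_one,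
    Fintype.card_fin]

/-- **Lemma 2 (iv)** [FergusonBaileyArno1999]: `|P_x| = √(n − 1)` for the Frobenius norm, stated as
`|P_x|² = ∑_{i,i'} (P_x)_{i,i'}² = n − 1`. [cite: FergusonBaileyArno1999, Lemma 2 (iv)] -/
theorem pslqP_frobenius_sq (x : Fin (d + 1) → ℝ) (h0 : ∀ i, x i ≠ 0) :
    ∑ i, ∑ i', pslqP x i i' ^ 2 = d := by
  have hPP : pslqP x * (pslqP x)ᵀ = pslqP x := by
    rw [pslqP_transpose, pslqP_mul_self x h0]
  have h : ∀ i, ∑ i', pslqP x i i' ^ 2 = pslqP x i i := fun i => by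
    have := congrFun (congrFun hPP i) i
    rw [Matrix.mul_apply] at this
    simp only [Matrix.transpose_apply] at this
    rw [← this]
    exact Finset.sum_congr rfl fun i' _ => by ring
  simp only [h]
  have := trace_pslqP x h0
  rw [Matrix.trace] at this
  simpa using this

/-- **Lemma 2 (v)** [FergusonBaileyArno1999]: `P_x zᵀ = zᵀ` for every `z ∈ x^⊥` (`∑ᵢ zᵢ xᵢ = 0`), for a
unit vector `x` with no zero coordinate. [cite: FergusonBaileyArno1999, Lemma 2 (v)] -/
theorem pslqP_mulVec_of_orthogonal (x : Fin (d + 1) → ℝ) (h0 : ∀ i, x i ≠ 0)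
    (h1 : ∑ i, x i ^ 2 = 1) (v : Fin (d + 1) → ℝ) (hv : ∑ i, v i * x i = 0) :
    pslqP x *ᵥ v = v := by
  rw [pslqP_eq x h0 h1]
  have := proj_fixes_orthogonal x 1 v hv
  rwa [one_smul] at this

/-- **Lemma 2 (vi)** [FergusonBaileyArno1999]: `P_x mᵀ = mᵀ` for every integer relation `m` of `x`
(`∑ᵢ mᵢ xᵢ = 0`). [cite: FergusonBaileyArno1999, Lemma 2 (vi)] -/
theorem pslqP_mulVec_relation (x : Fin (d + 1) → ℝ) (h0 : ∀ i, x i ≠ 0)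
    (h1 : ∑ i, x i ^ 2 = 1) (m : Fin (d + 1) → ℤ) (hrel : ∑ i, (m i : ℝ) * x i = 0) :
    (pslqP x *ᵥ fun i => (m i : ℝ)) = fun i => (m i : ℝ) :=
  pslqP_mulVec_of_orthogonal x h0 h1 _ hrel

/-! ### Theorem 1 in its printed form -/

/-- Padding an `n × (n − 1)` real matrix by a zero last column (the square matrix `(H | 0)` through which
the factored Theorem 1 of `PSLQRelationBound.lean` is applied). [folklore] -/
def padLastCol (H : Matrix (Fin (d + 1)) (Fin d) ℝ) : Matrix (Fin (d + 1)) (Fin (d + 1)) ℝ :=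
  Matrix.of fun i k => Fin.lastCases (0 : ℝ) (fun j => H i j) k

/-- Padding an `(n − 1) × n` real matrix by a zero last row (the square matrix `(R ; 0)`). [folklore] -/
def padLastRow (R : Matrix (Fin d) (Fin (d + 1)) ℝ) : Matrix (Fin (d + 1)) (Fin (d + 1)) ℝ :=
  Matrix.of fun k i => Fin.lastCases (0 : ℝ) (fun j => R j i) k

/-- Entries of the padded matrix: the first `n − 1` columns. [folklore] -/
@[simp] private theorem padLastCol_castSucc (H : Matrix (Fin (d + 1)) (Fin d) ℝ) (i : Fin (d + 1)) (j : Fin d) :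
    padLastCol H i j.castSucc = H i j := by simp [padLastCol]

/-- Entries of the padded matrix: the zero last column. [folklore] -/
@[simp] private theorem padLastCol_last (H : Matrix (Fin (d + 1)) (Fin d) ℝ) (i : Fin (d + 1)) :
    padLastCol H i (Fin.last d) = 0 := by simp [padLastCol]

/-- Entries of the padded matrix: the first `n − 1` rows. [folklore] -/
@[simp] private theorem padLastRow_castSucc (R : Matrix (Fin d) (Fin (d + 1)) ℝ) (j : Fin d) (i : Fin (d + 1)) :
    padLastRow R j.castSucc i = R j i := by simp [padLastRow]

/-- Entries of the padded matrix: the zero last row. [folklore] -/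
@[simp] private theorem padLastRow_last (R : Matrix (Fin d) (Fin (d + 1)) ℝ) (i : Fin (d + 1)) :
    padLastRow R (Fin.last d) i = 0 := by simp [padLastRow]

/-- `(H | 0) (R ; 0) = H R`. [folklore] -/
private theorem padLastCol_mul_padLastRow (H : Matrix (Fin (d + 1)) (Fin d) ℝ)
    (R : Matrix (Fin d) (Fin (d + 1)) ℝ) : padLastCol H * padLastRow R = H * R := by
  ext i i'
  rw [Matrix.mul_apply, Fin.sum_univ_castSucc, Matrix.mul_apply]
  simp

/-- Cauchy–Schwarz for one row (cf. the private helper of `PSLQRelationBound`). [folklore] -/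
private theorem abs_mulVec_le_sqrt_sum_sq' (R : Matrix (Fin (d + 1)) (Fin (d + 1)) ℝ)
    (hR : ∀ j, ∑ k, R j k ^ 2 ≤ 1) (v : Fin (d + 1) → ℝ) (j : Fin (d + 1)) :
    |(R *ᵥ v) j| ≤ Real.sqrt (∑ k, v k ^ 2) := by
  have hv : 0 ≤ ∑ k, v k ^ 2 := Finset.sum_nonneg fun k _ => sq_nonneg (v k)
  have hcs : (∑ k, R j k * v k) ^ 2 ≤ (∑ k, R j k ^ 2) * ∑ k, v k ^ 2 :=
    Finset.sum_mul_sq_le_sq_mul_sq _ _ _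
  have h2 : (∑ k, R j k * v k) ^ 2 ≤ ∑ k, v k ^ 2 :=
    hcs.trans ((mul_le_mul_of_nonneg_right (hR j) hv).trans_eq (one_mul _))
  have habs : |(R *ᵥ v) j| = Real.sqrt ((∑ k, R j k * v k) ^ 2) := by
    rw [Real.sqrt_sq_eq_abs]
    simp [Matrix.mulVec, dotProduct]
  rw [habs]
  exact Real.sqrt_le_sqrt h2

/-- **Theorem 1 of [FergusonBaileyArno1999] in its printed form (real case).** Let `x ∈ ℝⁿ` be a unit
vector with no zero coordinate, `m` an integer relation of `x` (`m ≠ 0`, `∑ᵢ mᵢ xᵢ = 0`), `A` an integer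
`n × n` matrix with `det A ≠ 0` (in the paper `A ∈ GL(n, ℤ)`), `Q` a real orthogonal `(n−1) × (n−1)`
matrix (`Qᵀ Q = I`), and suppose `H = A H_x Q` is lower trapezoidal (`h_{i,j} = 0` for `i < j`) with all
diagonal entries `h_{j,j} ≠ 0`. Then some diagonal entry satisfies `1 ≤ |h_{j,j}| · |m|` — in the words
of the printed proof (p. 355), "`1 ≤ |A_j mᵀ| ≤ |h_{j,j} Q_{H,j} mᵀ| ≤ |h_{j,j}| |mᵀ|`". Obtained from
the factored `FergusonBaileyArno1999_theorem1` with `P = P_x = Iₙ − xᵀ x` (Lemma 2 (ii), (vi)),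
`L = (A H_x Q | 0)`, `R = (Qᵀ H_xᵀ ; 0)`, `A P_x = L R`, the rows of `Qᵀ H_xᵀ` being orthonormal by
Lemma 1 (i). [cite: FergusonBaileyArno1999, Theorem 1] -/
theorem FergusonBaileyArno1999_theorem1_pslqH (x : Fin (d + 1) → ℝ) (h0 : ∀ i, x i ≠ 0)
    (h1 : ∑ i, x i ^ 2 = 1) (m : Fin (d + 1) → ℤ) (hm : m ≠ 0)
    (hrel : ∑ i, (m i : ℝ) * x i = 0)
    (A : Matrix (Fin (d + 1)) (Fin (d + 1)) ℤ) (hA : A.det ≠ 0)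
    (Q : Matrix (Fin d) (Fin d) ℝ) (hQ : Qᵀ * Q = 1)
    (H : Matrix (Fin (d + 1)) (Fin d) ℝ) (hH : H = A.map (Int.cast : ℤ → ℝ) * pslqH x * Q)
    (hlow : ∀ (i : Fin (d + 1)) (j : Fin d), i < j.castSucc → H i j = 0)
    (hdiag : ∀ j : Fin d, H j.castSucc j ≠ 0) :
    ∃ j : Fin d, 1 ≤ |H j.castSucc j| * Real.sqrt (∑ k, (m k : ℝ) ^ 2) := by
  have hQQ : Q * Qᵀ = 1 := mul_eq_one_comm.mp hQ
  set L := padLastCol H with hL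
  set R := padLastRow (Qᵀ * (pslqH x)ᵀ) with hR
  set P : Matrix (Fin (d + 1)) (Fin (d + 1)) ℝ := 1 - (1 : ℝ) • Matrix.vecMulVec x x with hP
  have hPfix : ∀ v : Fin (d + 1) → ℝ, ∑ i, v i * x i = 0 → P *ᵥ v = v :=
    fun v hv => proj_fixes_orthogonal x 1 v hv
  have hfac : A.map (Int.cast : ℤ → ℝ) * P = L * R := by
    rw [hL, hR, padLastCol_mul_padLastRow, hH, hP, one_smul, ← pslqH_mul_transpose_self x h0 h1]
    simp only [Matrix.mul_assoc]
    rw [← Matrix.mul_assoc Q, hQQ, Matrix.one_mul]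
  have hLtri : ∀ i k : Fin (d + 1), i < k → L i k = 0 := by
    intro i k hik
    induction k using Fin.lastCases with
    | last => simp [hL]
    | cast j => rw [hL, padLastCol_castSucc]; exact hlow i j hik
  have hLcol : ∀ k : Fin (d + 1), L k k = 0 → ∀ i, L i k = 0 := by
    intro k hk i
    induction k using Fin.lastCases with
    | last => simp [hL]
    | cast j =>
      rw [hL, padLastCol_castSucc] at hk
      exact absurd hk (hdiag j)
  have hRrow : ∀ j, ∑ k, R j k ^ 2 ≤ 1 := by
    intro j
    induction j using Fin.lastCases with
    | last => simp [hR]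
    | cast j0 =>
      have hRR : (Qᵀ * (pslqH x)ᵀ) * (Qᵀ * (pslqH x)ᵀ)ᵀ = 1 := by
        rw [Matrix.transpose_mul, Matrix.transpose_transpose, Matrix.transpose_transpose,
          Matrix.mul_assoc, ← Matrix.mul_assoc (pslqH x)ᵀ, pslqH_transpose_mul_self x h0,
          Matrix.one_mul, hQ]
      have := congrFun (congrFun hRR j0) j0
      rw [Matrix.mul_apply, Matrix.one_apply_eq] at this
      simp only [Matrix.transpose_apply] at this
      have h' : ∑ k, R j0.castSucc k ^ 2 = 1 := by
        rw [← this]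
        refine Finset.sum_congr rfl fun k _ => ?_
        rw [hR, padLastRow_castSucc]
        ring
      exact h'.le
  obtain ⟨j, hj0, hj⟩ := FergusonBaileyArno1999_theorem1 x m hm hrel A hA P L R hPfix hfac hLtri
    hLcol (Real.sqrt (∑ k, (m k : ℝ) ^ 2))
    (fun j => abs_mulVec_le_sqrt_sum_sq' R hRrow (fun i => (m i : ℝ)) j)
  induction j using Fin.lastCases with
  | last => simp [hL] at hj0
  | cast j0 =>
    refine ⟨j0, ?_⟩
    rw [hL, padLastCol_castSucc] at hj
    exact hj

/-- **Theorem 1 of [FergusonBaileyArno1999], the printed `min` form**: in the setting of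
`FergusonBaileyArno1999_theorem1_pslqH`, `min_{1 ≤ j ≤ n−1} 1/|h_{j,j}| ≤ |m|`, i.e. some `j` has
`1/|h_{j,j}| ≤ |m| = (∑ₖ m_k²)^{1/2}`. [cite: FergusonBaileyArno1999, Theorem 1] -/
theorem FergusonBaileyArno1999_theorem1_pslqH_min (x : Fin (d + 1) → ℝ) (h0 : ∀ i, x i ≠ 0)
    (h1 : ∑ i, x i ^ 2 = 1) (m : Fin (d + 1) → ℤ) (hm : m ≠ 0)
    (hrel : ∑ i, (m i : ℝ) * x i = 0)
    (A : Matrix (Fin (d + 1)) (Fin (d + 1)) ℤ) (hA : A.det ≠ 0)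
    (Q : Matrix (Fin d) (Fin d) ℝ) (hQ : Qᵀ * Q = 1)
    (H : Matrix (Fin (d + 1)) (Fin d) ℝ) (hH : H = A.map (Int.cast : ℤ → ℝ) * pslqH x * Q)
    (hlow : ∀ (i : Fin (d + 1)) (j : Fin d), i < j.castSucc → H i j = 0)
    (hdiag : ∀ j : Fin d, H j.castSucc j ≠ 0) :
    ∃ j : Fin d, 1 / |H j.castSucc j| ≤ Real.sqrt (∑ k, (m k : ℝ) ^ 2) := by
  obtain ⟨j, hj⟩ := FergusonBaileyArno1999_theorem1_pslqH x h0 h1 m hm hrel A hA Q hQ H hH hlow hdiag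
  refine ⟨j, ?_⟩
  have hpos : 0 < |H j.castSucc j| := abs_pos.mpr (hdiag j)
  rw [div_le_iff₀ hpos]
  simpa [mul_comm] using hj

/-- **Theorem 1 of [FergusonBaileyArno1999], the printed `max` form**: in the setting of
`FergusonBaileyArno1999_theorem1_pslqH`, `1/D ≤ |m|` for every real `D` with `|h_{j,j}| ≤ D` for all
`j` — in particular for `D = max_{1 ≤ j ≤ n−1} |h_{j,j}|`: "`1 / max_{1≤j≤n−1} |h_{j,j}| ≤ |m|`". This is
the EXCLUSION BOUND of PSLQ: no integer relation of Euclidean norm below `1 / max_j |h_{j,j}|`.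
[cite: FergusonBaileyArno1999, Theorem 1] -/
theorem FergusonBaileyArno1999_theorem1_pslqH_max (x : Fin (d + 1) → ℝ) (h0 : ∀ i, x i ≠ 0)
    (h1 : ∑ i, x i ^ 2 = 1) (m : Fin (d + 1) → ℤ) (hm : m ≠ 0)
    (hrel : ∑ i, (m i : ℝ) * x i = 0)
    (A : Matrix (Fin (d + 1)) (Fin (d + 1)) ℤ) (hA : A.det ≠ 0)
    (Q : Matrix (Fin d) (Fin d) ℝ) (hQ : Qᵀ * Q = 1)
    (H : Matrix (Fin (d + 1)) (Fin d) ℝ) (hH : H = A.map (Int.cast : ℤ → ℝ) * pslqH x * Q)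
    (hlow : ∀ (i : Fin (d + 1)) (j : Fin d), i < j.castSucc → H i j = 0)
    (hdiag : ∀ j : Fin d, H j.castSucc j ≠ 0) (D : ℝ) (hD : ∀ j : Fin d, |H j.castSucc j| ≤ D) :
    1 / D ≤ Real.sqrt (∑ k, (m k : ℝ) ^ 2) := by
  obtain ⟨j, hj⟩ := FergusonBaileyArno1999_theorem1_pslqH_min x h0 h1 m hm hrel A hA Q hQ H hH hlow
    hdiag
  have hpos : 0 < |H j.castSucc j| := abs_pos.mpr (hdiag j)
  exact (one_div_le_one_div_of_le hpos (hD j)).trans hj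

/-- **Theorem 1 of [FergusonBaileyArno1999] verbatim**, with `max_{1 ≤ j ≤ n−1} |h_{j,j}|` written as
the supremum `⨆ j, |h_{j,j}|` over `Fin (n − 1)`: `1 / max_j |h_{j,j}| ≤ |m|`. (Under the hypotheses a
relation exists, so `n ≥ 2` and `Fin (n − 1)` is nonempty; the supremum of the finitely many
`|h_{j,j}|` is their maximum.) [cite: FergusonBaileyArno1999, Theorem 1] -/
theorem FergusonBaileyArno1999_theorem1_pslqH_iSup (x : Fin (d + 1) → ℝ) (h0 : ∀ i, x i ≠ 0)
    (h1 : ∑ i, x i ^ 2 = 1) (m : Fin (d + 1) → ℤ) (hm : m ≠ 0)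
    (hrel : ∑ i, (m i : ℝ) * x i = 0)
    (A : Matrix (Fin (d + 1)) (Fin (d + 1)) ℤ) (hA : A.det ≠ 0)
    (Q : Matrix (Fin d) (Fin d) ℝ) (hQ : Qᵀ * Q = 1)
    (H : Matrix (Fin (d + 1)) (Fin d) ℝ) (hH : H = A.map (Int.cast : ℤ → ℝ) * pslqH x * Q)
    (hlow : ∀ (i : Fin (d + 1)) (j : Fin d), i < j.castSucc → H i j = 0)
    (hdiag : ∀ j : Fin d, H j.castSucc j ≠ 0) :
    1 / iSup (fun j : Fin d => |H j.castSucc j|) ≤ Real.sqrt (∑ k, (m k : ℝ) ^ 2) := by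
  refine FergusonBaileyArno1999_theorem1_pslqH_max x h0 h1 m hm hrel A hA Q hQ H hH hlow hdiag _ ?_
  intro j
  exact le_ciSup (Set.finite_range (fun j : Fin d => |H j.castSucc j|)).bddAbove j

end Literature.NumberTheory.DiophantineApproximation
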